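/-
Copyright (c) 2026. All rights reserved.
Released under Apache 2.0 license as described in the file LICENSE.
Authors: abc-iut cell, seat abc-iut-L6-t6 (the last sentence of [IUTchIII] Example 3.6 (iii), part 4:
the unit twists are ALL the indeterminacy; proof-only).
-/
import Literature.IUT.LogThetaLattice.GlobalFrobenioidModelsUnitTwist
import HarnessLib

/-!
# [IUTchIII] Example 3.6 (iii), last sentence — classification of the indeterminacy: an isomorphism of
# Frobenioids `𝓕⊛_𝔪𝔬𝔡 ⥲ 𝓕⊛_𝔪𝔬𝔡` fixing objects, Frobenius degrees and `F^×_mod` IS a unit twist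

S. Mochizuki, *Inter-universal Teichmüller Theory III*, kurims manuscript (May 2020), Example 3.6 (iii),
p. 108 (this seat's render `paper:url-4b091feeb646` p. 108) [claim key Mochizuki2012, status disputed
(D-0012)]: "… although the above isomorphism of Frobenioids is not necessarily determined by the condition
that it induce the identity morphism on `F^×_mod`, the induced isomorphism between the respective perfections
[hence also on realifications] of `𝓕⊛_𝔪𝔬𝔡`, `𝓕⊛_MOD` is completely determined by this condition."

Part 1 (`GlobalFrobenioidModelsUnitTwist.lean`) EXHIBITS the indeterminacy: the unit twists
`Ψ_u = FrakCat.unitTwist u hu`, `(n, f) ↦ (n, u · f · u^{−n})`, `u ∈ F^×_mod` a unit at every place.  Parts 2/3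
(`…PerfectionRigidity.lean`, `…RealificationRigidity.lean`) show that the twists die on THE perfection and on
THE realification.  THIS proof-only file closes the circle: the unit twists are the WHOLE indeterminacy.

**Classification theorem** (`FrakCat.eq_unitTwist_of_full`, `FrakCat.isUnitTwist_iff`).  Over the abstract
datum of Ex. 3.6 (ii) (`FrakCat F V Γ nonneg β` under the standing hypotheses `ModelHyps`: cones generating,
saturated, sharp), let `Ψ : 𝓕⊛_𝔪𝔬𝔡 ⥤ 𝓕⊛_𝔪𝔬𝔡` be a functor which (a) is the identity on objects, (b) preserves
Frobenius degrees, (c) fixes the rational function `f ∈ F^×_mod` of every LINEAR morphism ("induces the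
identity morphism on `F^×_mod`"), and (d) is FULL (e.g. an auto-equivalence — an isomorphism of Frobenioids).
Then `Ψ = Ψ_u` AS FUNCTORS for some `u ∈ F^×_mod` with `β_v(u) = 0` at every `v`; conversely every `Ψ_u` has
(a)–(d).  Mechanism ("one verifies immediately"): every morphism factors as `(n, f) = (n, 1) ≫ (1, f)` through
the unit-free arrow `(n, 1) : 𝔍 → 𝔍^{⊗n}` (`exists_pure_comp_linear`), so by (b)(c) `Ψ` is determined by its
values on unit-free arrows; those values do not depend on the arrow (`fn_map_eq_of_fn_eq_one`: naturality
against linear arrows, `(1, g) ≫ (n, 1) = (n, 1) ≫ (1, gⁿ)`, plus directedness of the cones — any two objects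
receive linear arrows from a common one, `exists_linear_to_both`), i.e. they are the values
`e(n) = fn Ψ(n, 1)` on the unit-free endomorphisms `(n, 1)` of the trivial object `𝒪`; there
`(n·m, 1) = (n, 1) ≫ (m, 1)` gives `e(n·m) = e(m) · e(n)^m`, whence `e(n) = e(2)^{n−1}` (`pureFn_eq_pow`) and
`fn Ψ(n, f) = f · w^{n−1}`, `w = e(2) = fn Ψ(2, 1)` (`fn_map_eq`); `β_v(w) ≥ 0` since `Ψ(2, 1) : 𝒪 → 𝒪` is a
morphism, `≤ 0` since fullness gives a preimage of `(2, 1)` with element `w⁻¹`, so `β_v(w) = 0` by sharpness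
and `Ψ = Ψ_u`, `u = w⁻¹`.  Without (d) the conclusion fails over the abstract datum (any `w` with `β_v(w) ≥ 0`
at every `v` gives the divisor-raising twist `(n, f) ↦ (n, f · w^{n−1})`); at the number-field model `u` is a
root of unity (`GlobalFrobenioidModelsPlacesUnits.lean`; `Prop37.beta_eq_zero_iff_isOfFinOrder`).

CONSEQUENCE for the printed sentence (READING as in parts 1–3: functors on the nose): among the isomorphisms
of Frobenioids `𝓕⊛_𝔪𝔬𝔡 ⥲ 𝓕⊛_𝔪𝔬𝔡` with (a)–(c) there is exactly the freedom `u ∈ ⋂_v ker β_v` (the roots of unity of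
`F_mod` at the model), and by parts 2/3 all of them induce THE SAME functor on the perfection and on the
realification — "completely determined by this condition".  Theorems only; no new definitions (the degree-`2`
unit-free endomorphism of `𝒪` is part 1's `FrakCat.frobTwo`).  HONEST FRAMING: elementary category theory of
the tree's own model of Ex. 3.6; nothing here bears on [IUTchIII] Cor. 3.12; typed ≠ endorsed.
-/

namespace Literature.IUT.LogThetaLattice

namespace GlobalFrobenioidModels

open CategoryTheory

universe u

variable {F : Type u} [Field F] {V : Type u} {Γ : V → Type u} [∀ v, AddCommGroup (Γ v)]
  {nonneg : ∀ v, AddSubmonoid (Γ v)} {β : ∀ v, Additive Fˣ →+ Γ v}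

namespace FrakCat

/-! ### Unit-free arrows `(n, 1)` and the factorisation `(n, f) = (n, 1) ≫ (1, f)` -/

/-- `(n, 1) : 𝒪 → 𝒪` is an endomorphism of the trivial family for every `n ≥ 1`.
([IUTchIII] Ex 3.6 (ii) p.108) [claim: Mochizuki2012, status: disputed] -/
theorem isHom_zero_pure (n : ℕ+) :
    FrakObj.IsHom (nonneg := nonneg) (β := β) (of 0 : FrakCat F V Γ nonneg β).obj
      (of 0 : FrakCat F V Γ nonneg β).obj n 1 := by
  intro v
  rw [ofMul_one, map_zero, zero_add]
  show ((n : ℕ) : ℤ) • (0 : FrakObj V Γ).cls v - (0 : FrakObj V Γ).cls v ∈ nonneg v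
  rw [FrakObj.cls_zero, zsmul_zero, sub_zero]
  exact (nonneg v).zero_mem

/-- `(n, 1) : 𝔍 → 𝔍^{⊗n}` satisfies the integrality condition (with equality). ([IUTchIII] Ex 3.6 (ii) p.108) [claim: Mochizuki2012, status: disputed] -/
theorem isHom_frob (X : FrakCat F V Γ nonneg β) (n : ℕ+) :
    FrakObj.IsHom (nonneg := nonneg) (β := β) X.obj
      (of (((n : ℕ) : ℤ) • X.obj) : FrakCat F V Γ nonneg β).obj n 1 := by
  intro v
  rw [ofMul_one, map_zero, zero_add]
  show ((n : ℕ) : ℤ) • X.obj.cls v - ((n : ℕ) : ℤ) • X.obj.cls v ∈ nonneg v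
  rw [sub_self]
  exact (nonneg v).zero_mem

/-- The linear tail `(1, f) : 𝔍₁^{⊗n} → 𝔍₂` of a morphism `(n, f) : 𝔍₁ → 𝔍₂` is a morphism.
([IUTchIII] Ex 3.6 (ii) p.108) [claim: Mochizuki2012, status: disputed] -/
theorem isHom_tail {X Y : FrakCat F V Γ nonneg β} (φ : X ⟶ Y) :
    FrakObj.IsHom (nonneg := nonneg) (β := β) (of (((deg φ : ℕ) : ℤ) • X.obj) : FrakCat F V Γ nonneg β).obj
      Y.obj 1 (fn φ) := by
  intro v
  have hφ := mem_nonneg φ v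
  show β v (Additive.ofMul (fn φ)) + (((1 : ℕ+) : ℕ) : ℤ) • (((deg φ : ℕ) : ℤ) • X.obj.cls v) - Y.obj.cls v ∈
    nonneg v
  rwa [PNat.one_coe, Nat.cast_one, one_zsmul]

/-- **`(n, f) = (n, 1) ≫ (1, f)`**: every morphism of `𝓕⊛_𝔪𝔬𝔡` is a unit-free arrow of the same Frobenius degree
followed by a LINEAR morphism with the same rational function. ([IUTchIII] Ex 3.6 (ii) p.108) [claim: Mochizuki2012, status: disputed] -/
theorem exists_pure_comp_linear {X Y : FrakCat F V Γ nonneg β} (φ : X ⟶ Y) :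
    ∃ (Z : FrakCat F V Γ nonneg β) (χ : X ⟶ Z) (l : Z ⟶ Y),
      fn χ = 1 ∧ deg χ = deg φ ∧ deg l = 1 ∧ fn l = fn φ ∧ χ ≫ l = φ :=
  ⟨of (((deg φ : ℕ) : ℤ) • X.obj), homMk (deg φ) 1 (isHom_frob X (deg φ)), homMk 1 (fn φ) (isHom_tail φ),
    rfl, rfl, rfl, rfl, hom_ext (by rw [deg_comp, deg_homMk, deg_homMk, one_mul]) (by
      rw [fn_comp, fn_homMk, fn_homMk, deg_homMk, one_pow, mul_one])⟩

/-- A unit-free arrow `(n, 1) : 𝔍 → 𝔍'` factors through `(n, 1) : 𝔍 → 𝔍^{⊗n}` by the unit-free LINEAR arrow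
`(1, 1) : 𝔍^{⊗n} → 𝔍'`. ([IUTchIII] Ex 3.6 (ii) p.108) [claim: Mochizuki2012, status: disputed] -/
theorem isHom_one_one_of_fn_eq_one {X Z : FrakCat F V Γ nonneg β} (χ : X ⟶ Z) (hχ : fn χ = 1) :
    FrakObj.IsHom (nonneg := nonneg) (β := β) (of (((deg χ : ℕ) : ℤ) • X.obj) : FrakCat F V Γ nonneg β).obj
      Z.obj 1 1 := by
  have h := isHom_tail χ
  rwa [hχ] at h

/-- Naturality of the unit-free arrows against linear morphisms: `(1, g) ≫ (n, 1) = (n, 1) ≫ (1, gⁿ)` —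
the right-hand linear arrow `(1, gⁿ) : 𝔍'^{⊗n} → 𝔍^{⊗n}` is a morphism. ([IUTchIII] Ex 3.6 (ii) p.108) [claim: Mochizuki2012, status: disputed] -/
theorem isHom_pow {X' X : FrakCat F V Γ nonneg β} (ψ : X' ⟶ X) (hψ : deg ψ = 1) (n : ℕ+) :
    FrakObj.IsHom (nonneg := nonneg) (β := β) (of (((n : ℕ) : ℤ) • X'.obj) : FrakCat F V Γ nonneg β).obj
      (of (((n : ℕ) : ℤ) • X.obj) : FrakCat F V Γ nonneg β).obj 1 (fn ψ ^ (n : ℕ)) := by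
  intro v
  have key : β v (Additive.ofMul (fn ψ)) + X'.obj.cls v - X.obj.cls v ∈ nonneg v := by
    have h := mem_nonneg ψ v
    rwa [hψ, PNat.one_coe, Nat.cast_one, one_zsmul] at h
  have e : β v (Additive.ofMul (fn ψ ^ (n : ℕ))) + (((1 : ℕ+) : ℕ) : ℤ) • (((n : ℕ) : ℤ) • X'.obj.cls v) -
      ((n : ℕ) : ℤ) • X.obj.cls v = (n : ℕ) • (β v (Additive.ofMul (fn ψ)) + X'.obj.cls v - X.obj.cls v) := by
    rw [ofMul_pow, map_nsmul, PNat.one_coe, Nat.cast_one, one_zsmul, smul_sub, smul_add, natCast_zsmul,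
      natCast_zsmul]
  show β v (Additive.ofMul (fn ψ ^ (n : ℕ))) + (((1 : ℕ+) : ℕ) : ℤ) • (((n : ℕ) : ℤ) • X'.obj.cls v) -
      ((n : ℕ) : ℤ) • X.obj.cls v ∈ nonneg v
  rw [e]
  exact AddSubmonoid.nsmul_mem _ key _

/-! ### Any two objects receive linear morphisms from a common object -/

section Directed

variable (H : ModelHyps nonneg β)
include H

/-- **Directedness of `𝓕⊛_𝔪𝔬𝔡`**: any two objects `𝔍₁, 𝔍₂` receive LINEAR morphisms `(1, 1)` from a common
object (namely `𝔍₁ ⊗ (𝔍₂ ⊗ 𝔍₁^{⊗(-1)})⁺`, using that every class is a difference of effective classes).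
([IUTchIII] Ex 3.6 (ii) p.107) [claim: Mochizuki2012, status: disputed] -/
theorem exists_linear_to_both (X₁ X₂ : FrakCat F V Γ nonneg β) :
    ∃ (X' : FrakCat F V Γ nonneg β) (ψ₁ : X' ⟶ X₁) (ψ₂ : X' ⟶ X₂), deg ψ₁ = 1 ∧ deg ψ₂ = 1 := by
  have hpn : ∀ v, (posPart H (X₂.obj - X₁.obj)).cls v - (negPart H (X₂.obj - X₁.obj)).cls v =
      X₂.obj.cls v - X₁.obj.cls v := fun v => by
    have h := congrArg (fun J : FrakObj V Γ => J.cls v) (posPart_sub_negPart H (X₂.obj - X₁.obj))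
    simpa only [FrakObj.cls_sub] using h
  refine ⟨of (X₁.obj + posPart H (X₂.obj - X₁.obj)), homMk 1 1 ?_, homMk 1 1 ?_, rfl, rfl⟩
  · intro v
    rw [ofMul_one, map_zero, zero_add]
    show (((1 : ℕ+) : ℕ) : ℤ) • (X₁.obj.cls v + (posPart H (X₂.obj - X₁.obj)).cls v) - X₁.obj.cls v ∈
      nonneg v
    rw [PNat.one_coe, Nat.cast_one, one_zsmul, add_sub_cancel_left]
    exact posPart_mem H _ v
  · intro v
    rw [ofMul_one, map_zero, zero_add]
    show (((1 : ℕ+) : ℕ) : ℤ) • (X₁.obj.cls v + (posPart H (X₂.obj - X₁.obj)).cls v) - X₂.obj.cls v ∈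
      nonneg v
    rw [PNat.one_coe, Nat.cast_one, one_zsmul]
    have e : X₁.obj.cls v + (posPart H (X₂.obj - X₁.obj)).cls v - X₂.obj.cls v =
        (negPart H (X₂.obj - X₁.obj)).cls v := by
      calc X₁.obj.cls v + (posPart H (X₂.obj - X₁.obj)).cls v - X₂.obj.cls v
          = (posPart H (X₂.obj - X₁.obj)).cls v - (X₂.obj.cls v - X₁.obj.cls v) := by abel
        _ = (posPart H (X₂.obj - X₁.obj)).cls v - ((posPart H (X₂.obj - X₁.obj)).cls v -
              (negPart H (X₂.obj - X₁.obj)).cls v) := by rw [hpn]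
        _ = (negPart H (X₂.obj - X₁.obj)).cls v := by abel
    rw [e]
    exact negPart_mem H _ v

end Directed

/-- `deg` of an `eqToHom` of `𝓕⊛_𝔪𝔬𝔡` is `1` (abstract datum; the number-field-model instance is
abc-iut-w4-d002's `FrakCat.deg_eqToHom`). ([IUTchIII] Ex 3.6 (ii) p.108) [claim: Mochizuki2012, status: disputed] -/
theorem deg_eqToHom_eq_one {X Y : FrakCat F V Γ nonneg β} (h : X = Y) : deg (eqToHom h) = 1 := by
  subst h; rfl

/-- `fn` of an `eqToHom` of `𝓕⊛_𝔪𝔬𝔡` is `1` (abstract datum; cf. abc-iut-w4-d002's `FrakCat.fn_eqToHom` at the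
number-field model). ([IUTchIII] Ex 3.6 (ii) p.108) [claim: Mochizuki2012, status: disputed] -/
theorem fn_eqToHom_eq_one {X Y : FrakCat F V Γ nonneg β} (h : X = Y) : fn (eqToHom h) = 1 := by
  subst h; rfl

/-! ### Classification of object-fixing, degree-preserving, `F^×_mod`-fixing functors -/

section Classification

variable (Ψ : FrakCat F V Γ nonneg β ⥤ FrakCat F V Γ nonneg β)
  (hdeg : ∀ ⦃X Y : FrakCat F V Γ nonneg β⦄ (φ : X ⟶ Y), deg (Ψ.map φ) = deg φ)
  (hlin : ∀ ⦃X Y : FrakCat F V Γ nonneg β⦄ (φ : X ⟶ Y), deg φ = 1 → fn (Ψ.map φ) = fn φ)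
include hdeg hlin

/-- Post-composing with a LINEAR morphism multiplies the element of `Ψ(−)` by its (fixed) rational function.
([IUTchIII] Ex 3.6 (iii) p.108) [claim: Mochizuki2012, status: disputed] -/
theorem fn_map_comp_linear {X Z Y : FrakCat F V Γ nonneg β} (χ : X ⟶ Z) (l : Z ⟶ Y) (hl : deg l = 1) :
    fn (Ψ.map (χ ≫ l)) = fn l * fn (Ψ.map χ) := by
  rw [Functor.map_comp, fn_comp, hlin l hl, hdeg, hl, PNat.one_coe, pow_one]

/-- Pre-composing with a LINEAR morphism `(1, g)` multiplies the element of `Ψ(−)` by `g^{deg}`.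
([IUTchIII] Ex 3.6 (iii) p.108) [claim: Mochizuki2012, status: disputed] -/
theorem fn_map_linear_comp {X' X Z : FrakCat F V Γ nonneg β} (l : X' ⟶ X) (hl : deg l = 1) (χ : X ⟶ Z) :
    fn (Ψ.map (l ≫ χ)) = fn (Ψ.map χ) * fn l ^ (deg χ : ℕ) := by
  rw [Functor.map_comp, fn_comp, hlin l hl, hdeg]

/-- **`Ψ` is determined by its values on unit-free arrows**: `fn Ψ(φ) = f · fn Ψ(χ)` for any factorisation
`φ = χ ≫ l` with `l` linear, `fn l = f`. ([IUTchIII] Ex 3.6 (iii) p.108) [claim: Mochizuki2012, status: disputed] -/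
theorem fn_map_eq_mul_of_fac {X Z Y : FrakCat F V Γ nonneg β} (φ : X ⟶ Y) (χ : X ⟶ Z) (l : Z ⟶ Y)
    (hl : deg l = 1) (hfac : χ ≫ l = φ) : fn (Ψ.map φ) = fn l * fn (Ψ.map χ) := by
  rw [← hfac, fn_map_comp_linear Ψ hdeg hlin χ l hl]

/-- The value on a unit-free arrow `(n, 1) : 𝔍 → 𝔍'` only depends on its canonical factor `(n, 1) : 𝔍 → 𝔍^{⊗n}`.
([IUTchIII] Ex 3.6 (iii) p.108) [claim: Mochizuki2012, status: disputed] -/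
theorem fn_map_eq_canonical {X Z : FrakCat F V Γ nonneg β} (χ : X ⟶ Z) (hχ : fn χ = 1) :
    fn (Ψ.map χ) = fn (Ψ.map (homMk (deg χ) 1 (isHom_frob X (deg χ)) :
      X ⟶ of (((deg χ : ℕ) : ℤ) • X.obj))) := by
  have hfac : (homMk (deg χ) 1 (isHom_frob X (deg χ)) : X ⟶ of (((deg χ : ℕ) : ℤ) • X.obj)) ≫
      (homMk 1 1 (isHom_one_one_of_fn_eq_one χ hχ) : of (((deg χ : ℕ) : ℤ) • X.obj) ⟶ Z) = χ :=
    hom_ext (by rw [deg_comp, deg_homMk, deg_homMk, one_mul]) (by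
      rw [fn_comp, fn_homMk, fn_homMk, one_pow, mul_one, hχ])
  rw [fn_map_eq_mul_of_fac Ψ hdeg hlin χ _ _ rfl hfac, fn_homMk, one_mul]

/-- The canonical values do not change along linear morphisms `𝔍' → 𝔍`. ([IUTchIII] Ex 3.6 (iii) p.108) [claim: Mochizuki2012, status: disputed] -/
theorem fn_map_canonical_eq_of_linear {X' X : FrakCat F V Γ nonneg β} (ψ : X' ⟶ X) (hψ : deg ψ = 1) (n : ℕ+) :
    fn (Ψ.map (homMk n 1 (isHom_frob X n) : X ⟶ of (((n : ℕ) : ℤ) • X.obj))) =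
      fn (Ψ.map (homMk n 1 (isHom_frob X' n) : X' ⟶ of (((n : ℕ) : ℤ) • X'.obj))) := by
  -- `(1, g) ≫ (n, 1) = (n, 1) ≫ (1, gⁿ)`
  have hsq : ψ ≫ (homMk n 1 (isHom_frob X n) : X ⟶ of (((n : ℕ) : ℤ) • X.obj)) =
      (homMk n 1 (isHom_frob X' n) : X' ⟶ of (((n : ℕ) : ℤ) • X'.obj)) ≫
        (homMk 1 (fn ψ ^ (n : ℕ)) (isHom_pow ψ hψ n) :
          of (((n : ℕ) : ℤ) • X'.obj) ⟶ of (((n : ℕ) : ℤ) • X.obj)) :=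
    hom_ext (by rw [deg_comp, deg_comp, deg_homMk, deg_homMk, deg_homMk, hψ, one_mul, mul_one]) (by
      rw [fn_comp, fn_comp, fn_homMk, fn_homMk, fn_homMk, deg_homMk, deg_homMk, one_mul, PNat.one_coe,
        pow_one, mul_one])
  have h := congrArg (fun χ => fn (Ψ.map χ)) hsq
  beta_reduce at h
  rw [fn_map_linear_comp Ψ hdeg hlin ψ hψ, fn_map_comp_linear Ψ hdeg hlin _ _ (deg_homMk _ _ _), deg_homMk,
    fn_homMk] at h
  exact mul_right_cancel (h.trans (mul_comm _ _))

variable (H : ModelHyps nonneg β)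
include H

/-- **The value of `Ψ` on a unit-free arrow depends only on its Frobenius degree** (directedness): it is the
value `e(n) = fn Ψ(n, 1)` on the unit-free endomorphism `(n, 1)` of the trivial object `𝒪`.
([IUTchIII] Ex 3.6 (iii) p.108) [claim: Mochizuki2012, status: disputed] -/
theorem fn_map_eq_of_fn_eq_one {X Z : FrakCat F V Γ nonneg β} (χ : X ⟶ Z) (hχ : fn χ = 1) :
    fn (Ψ.map χ) = fn (Ψ.map (homMk (deg χ) 1 (isHom_zero_pure (deg χ)) :
      (of 0 : FrakCat F V Γ nonneg β) ⟶ of 0)) := by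
  obtain ⟨X', ψ₁, ψ₂, h₁, h₂⟩ := exists_linear_to_both H X (of 0 : FrakCat F V Γ nonneg β)
  exact (fn_map_eq_canonical Ψ hdeg hlin χ hχ).trans <|
    (fn_map_canonical_eq_of_linear Ψ hdeg hlin ψ₁ h₁ (deg χ)).trans <|
      (fn_map_canonical_eq_of_linear Ψ hdeg hlin ψ₂ h₂ (deg χ)).symm.trans
        (fn_map_eq_canonical Ψ hdeg hlin _ (fn_homMk _ _ _)).symm

/-- `fn Ψ(n, f) = f · e(n)`. ([IUTchIII] Ex 3.6 (iii) p.108) [claim: Mochizuki2012, status: disputed] -/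
theorem fn_map_eq_mul_pureFn {X Y : FrakCat F V Γ nonneg β} (φ : X ⟶ Y) :
    fn (Ψ.map φ) = fn φ * fn (Ψ.map (homMk (deg φ) 1 (isHom_zero_pure (deg φ)) :
      (of 0 : FrakCat F V Γ nonneg β) ⟶ of 0)) := by
  obtain ⟨Z, χ, l, hχ, hdχ, hl, hfl, hfac⟩ := exists_pure_comp_linear φ
  rw [fn_map_eq_mul_of_fac Ψ hdeg hlin φ χ l hl hfac, hfl, fn_map_eq_of_fn_eq_one Ψ hdeg hlin H χ hχ, hdχ]

omit hlin H in
/-- **`e(n·m) = e(m) · e(n)^m`**: `(n·m, 1) = (n, 1) ≫ (m, 1)` on `𝒪`. ([IUTchIII] Ex 3.6 (iii) p.108) [claim: Mochizuki2012, status: disputed] -/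
theorem pureFn_mul (n m : ℕ+) :
    fn (Ψ.map (homMk (n * m) 1 (isHom_zero_pure (n * m)) : (of 0 : FrakCat F V Γ nonneg β) ⟶ of 0)) =
      fn (Ψ.map (homMk m 1 (isHom_zero_pure m) : (of 0 : FrakCat F V Γ nonneg β) ⟶ of 0)) *
        fn (Ψ.map (homMk n 1 (isHom_zero_pure n) : (of 0 : FrakCat F V Γ nonneg β) ⟶ of 0)) ^ (m : ℕ) := by
  have hfac : (homMk n 1 (isHom_zero_pure n) : (of 0 : FrakCat F V Γ nonneg β) ⟶ of 0) ≫
      (homMk m 1 (isHom_zero_pure m) : (of 0 : FrakCat F V Γ nonneg β) ⟶ of 0) =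
        homMk (n * m) 1 (isHom_zero_pure (n * m)) :=
    hom_ext (by rw [deg_comp, deg_homMk, deg_homMk, deg_homMk, mul_comm]) (by
      rw [fn_comp, fn_homMk, fn_homMk, fn_homMk, one_pow, mul_one])
  rw [← hfac, Functor.map_comp, fn_comp, hdeg, deg_homMk]

omit hlin H in
/-- **`e(n) = e(2)^{n−1}`** (compare `(2n, 1) = (2, 1) ≫ (n, 1) = (n, 1) ≫ (2, 1)`), where `e(2) = fn Ψ(2, 1)` is
the value on part 1's `frobTwo`. ([IUTchIII] Ex 3.6 (iii) p.108) [claim: Mochizuki2012, status: disputed] -/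
theorem pureFn_eq_pow (n : ℕ+) :
    fn (Ψ.map (homMk n 1 (isHom_zero_pure n) : (of 0 : FrakCat F V Γ nonneg β) ⟶ of 0)) =
      fn (Ψ.map (frobTwo (nonneg := nonneg) (β := β))) ^ ((n : ℕ) - 1) := by
  have h := pureFn_mul Ψ hdeg n 2
  have e2 : (homMk 2 1 (isHom_zero_pure 2) : (of 0 : FrakCat F V Γ nonneg β) ⟶ of 0) = frobTwo := rfl
  rw [mul_comm n 2, pureFn_mul Ψ hdeg 2 n, e2] at h
  -- `h : e n * e 2 ^ n = e 2 * e n ^ 2`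
  set a := fn (Ψ.map (homMk n 1 (isHom_zero_pure n) : (of 0 : FrakCat F V Γ nonneg β) ⟶ of 0))
  set w := fn (Ψ.map (frobTwo (nonneg := nonneg) (β := β)))
  have hn : (n : ℕ) = ((n : ℕ) - 1) + 1 := (Nat.sub_add_cancel n.pos).symm
  have h' : a * (w ^ ((n : ℕ) - 1) * w) = a * (a * w) := by
    calc a * (w ^ ((n : ℕ) - 1) * w) = a * w ^ (n : ℕ) := by rw [← pow_succ, ← hn]
      _ = w * a ^ ((2 : ℕ+) : ℕ) := h
      _ = a * (a * w) := by rw [show ((2 : ℕ+) : ℕ) = 2 from rfl, pow_two, mul_comm w (a * a), mul_assoc]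
  exact (mul_right_cancel (mul_left_cancel h')).symm

/-- **The shape of `Ψ`**: `fn Ψ(n, f) = f · w^{n−1}` with `w = fn Ψ(2, 1)` (`Ψ` on part 1's `frobTwo`).
([IUTchIII] Ex 3.6 (iii) p.108) [claim: Mochizuki2012, status: disputed] -/
theorem fn_map_eq {X Y : FrakCat F V Γ nonneg β} (φ : X ⟶ Y) :
    fn (Ψ.map φ) = fn φ * fn (Ψ.map (frobTwo (nonneg := nonneg) (β := β))) ^ ((deg φ : ℕ) - 1) := by
  rw [fn_map_eq_mul_pureFn Ψ hdeg hlin H φ, pureFn_eq_pow Ψ hdeg]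

variable (hobj : ∀ X : FrakCat F V Γ nonneg β, Ψ.obj X = X)
include hobj

omit hdeg hlin H in
/-- The twisting element `w = fn Ψ(2, 1)` satisfies `β_v(w) ≥ 0` at every place (because `Ψ(2, 1) : 𝒪 → 𝒪` is a
morphism). ([IUTchIII] Ex 3.6 (iii) p.108) [claim: Mochizuki2012, status: disputed] -/
theorem beta_fn_map_frobTwo_mem (v : V) :
    β v (Additive.ofMul (fn (Ψ.map (frobTwo (nonneg := nonneg) (β := β))))) ∈ nonneg v := by
  have h0 : (Ψ.obj (of 0 : FrakCat F V Γ nonneg β)).obj.cls v = 0 := by rw [hobj]; rfl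
  have h := mem_nonneg (Ψ.map (frobTwo (nonneg := nonneg) (β := β))) v
  rwa [h0, zsmul_zero, add_zero, sub_zero] at h

variable (hfull : ∀ ⦃X Y : FrakCat F V Γ nonneg β⦄ (τ : Ψ.obj X ⟶ Ψ.obj Y), ∃ φ : X ⟶ Y, Ψ.map φ = τ)
include hfull

/-- **Fullness forces `β_v(w) = 0`**: a preimage of `(2, 1) : 𝒪 → 𝒪` under `Ψ` has element `w⁻¹`, which must be
integral, and the cone is sharp. ([IUTchIII] Ex 3.6 (iii) p.108) [claim: Mochizuki2012, status: disputed] -/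
theorem beta_fn_map_frobTwo_eq_zero (v : V) :
    β v (Additive.ofMul (fn (Ψ.map (frobTwo (nonneg := nonneg) (β := β))))) = 0 := by
  set w := fn (Ψ.map (frobTwo (nonneg := nonneg) (β := β)))
  have h0 : (Ψ.obj (of 0 : FrakCat F V Γ nonneg β)).obj = 0 := by rw [hobj]; rfl
  -- the morphism `(2, 1) : Ψ 𝒪 → Ψ 𝒪` of the target and a preimage of it
  have hτ : FrakObj.IsHom (nonneg := nonneg) (β := β) (Ψ.obj (of 0 : FrakCat F V Γ nonneg β)).obj
      (Ψ.obj (of 0 : FrakCat F V Γ nonneg β)).obj 2 1 := by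
    rw [h0]
    exact isHom_two_one
  obtain ⟨φ₀, hφ₀⟩ := hfull (homMk 2 1 hτ)
  have hd : deg φ₀ = 2 := by rw [← hdeg, hφ₀, deg_homMk]
  have hf : fn φ₀ = w⁻¹ := by
    have h := fn_map_eq Ψ hdeg hlin H φ₀
    rw [hφ₀, fn_homMk, hd, show ((2 : ℕ+) : ℕ) - 1 = 1 from rfl, pow_one] at h
    exact eq_inv_of_mul_eq_one_left h.symm
  -- integrality of the preimage: `β_v(w⁻¹) ≥ 0`
  have hneg : -β v (Additive.ofMul w) ∈ nonneg v := by
    have h := mem_nonneg φ₀ v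
    rw [hf, ofMul_inv, map_neg] at h
    have e0 : (of 0 : FrakCat F V Γ nonneg β).obj.cls v = 0 := rfl
    rwa [e0, zsmul_zero, add_zero, sub_zero] at h
  exact H.sharp v _ (beta_fn_map_frobTwo_mem Ψ hobj v) hneg

/-- **The twisting unit**: `u := w⁻¹` is a unit at every place and `fn Ψ(n, f) = u · f · u^{−n}`.
([IUTchIII] Ex 3.6 (iii) p.108) [claim: Mochizuki2012, status: disputed] -/
theorem exists_unit_fn_map_eq :
    ∃ u : Fˣ, (∀ v, β v (Additive.ofMul u) = 0) ∧
      ∀ ⦃X Y : FrakCat F V Γ nonneg β⦄ (φ : X ⟶ Y), fn (Ψ.map φ) = u * fn φ * u⁻¹ ^ (deg φ : ℕ) := by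
  refine ⟨(fn (Ψ.map (frobTwo (nonneg := nonneg) (β := β))))⁻¹, fun v => ?_, fun X Y φ => ?_⟩
  · rw [ofMul_inv, map_neg, beta_fn_map_frobTwo_eq_zero Ψ hdeg hlin H hobj hfull v, neg_zero]
  · rw [inv_inv, fn_map_eq Ψ hdeg hlin H φ]
    set w := fn (Ψ.map (frobTwo (nonneg := nonneg) (β := β)))
    obtain ⟨k, hk⟩ : ∃ k : ℕ, (deg φ : ℕ) = k + 1 := ⟨(deg φ : ℕ) - 1, (Nat.sub_add_cancel (deg φ).pos).symm⟩
    rw [hk, Nat.add_sub_cancel, pow_succ]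
    calc fn φ * w ^ k = fn φ * w ^ k * (w⁻¹ * w) := by rw [inv_mul_cancel, mul_one]
      _ = w⁻¹ * fn φ * (w ^ k * w) := by simp only [mul_assoc, mul_comm, mul_left_comm]

/-- **[IUTchIII] Ex. 3.6 (iii) — CLASSIFICATION OF THE INDETERMINACY.**  A full functor
`Ψ : 𝓕⊛_𝔪𝔬𝔡 ⥤ 𝓕⊛_𝔪𝔬𝔡` (e.g. an isomorphism of Frobenioids `𝓕⊛_𝔪𝔬𝔡 ⥲ 𝓕⊛_𝔪𝔬𝔡`) which is the identity on objects,
preserves Frobenius degrees and induces the identity on `F^×_mod` (fixes every linear morphism's rational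
function) IS A UNIT TWIST: `Ψ = Ψ_u` for some `u ∈ F^×_mod` with `β_v(u) = 0` at every place.
([IUTchIII] Ex 3.6 (iii) p.108) [claim: Mochizuki2012, status: disputed] -/
theorem eq_unitTwist_of_full :
    ∃ (u : Fˣ) (hu : ∀ v, β v (Additive.ofMul u) = 0), Ψ = unitTwist u hu := by
  obtain ⟨u, hu, hfn⟩ := exists_unit_fn_map_eq Ψ hdeg hlin H hobj hfull
  refine ⟨u, hu, CategoryTheory.Functor.ext hobj fun X Y φ => hom_ext ?_ ?_⟩
  · rw [deg_comp, deg_comp, deg_eqToHom_eq_one, deg_eqToHom_eq_one, deg_unitTwist_map, hdeg, one_mul, mul_one]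
  · rw [fn_comp, fn_comp, fn_eqToHom_eq_one, fn_eqToHom_eq_one, deg_eqToHom_eq_one, PNat.one_coe, pow_one,
      one_pow, mul_one, one_mul, fn_unitTwist_map, hfn]

end Classification

/-- **[IUTchIII] Ex. 3.6 (iii): the indeterminacy is EXACTLY the unit twists** (iff form, for auto-equivalences
of `𝓕⊛_𝔪𝔬𝔡`): an auto-equivalence is the identity on objects, preserves Frobenius degrees and induces the identity
on `F^×_mod` if and only if it is `Ψ_u` for a unit `u` at every place. ([IUTchIII] Ex 3.6 (iii) p.108) [claim: Mochizuki2012, status: disputed] -/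
theorem isUnitTwist_iff (H : ModelHyps nonneg β) (Ψ : FrakCat F V Γ nonneg β ⥤ FrakCat F V Γ nonneg β)
    [Ψ.IsEquivalence] :
    ((∀ X, Ψ.obj X = X) ∧ (∀ ⦃X Y : FrakCat F V Γ nonneg β⦄ (φ : X ⟶ Y), deg (Ψ.map φ) = deg φ) ∧
        ∀ ⦃X Y : FrakCat F V Γ nonneg β⦄ (φ : X ⟶ Y), deg φ = 1 → fn (Ψ.map φ) = fn φ) ↔
      ∃ (u : Fˣ) (hu : ∀ v, β v (Additive.ofMul u) = 0), Ψ = unitTwist u hu := by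
  constructor
  · rintro ⟨hobj, hdeg, hlin⟩
    exact eq_unitTwist_of_full Ψ hdeg hlin H hobj (fun X Y τ => Ψ.map_surjective τ)
  · rintro ⟨u, hu, rfl⟩
    exact ⟨fun _ => rfl, fun _ _ φ => deg_unitTwist_map u hu φ, fun _ _ φ h => by
      rw [unitTwist_map_of_deg_eq_one u hu φ h]⟩

end FrakCat

end GlobalFrobenioidModels

end Literature.IUT.LogThetaLattice
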